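import Mathlib
import Summits.CriticalPhenomena.Ising3DConformalLimit.Theses.HyperoctahedralRP
import Summits.CriticalPhenomena.Ising3DConformalLimit.Theorems.HRP2Rigidity.Negative.LoadBearing
import Summits.CriticalPhenomena.Ising3DConformalLimit.Theorems.HRP2Rigidity.Negative.Descent
import Literature.MathematicalPhysics.QuantumFieldTheory.LatticeMirrorNormals
import Literature.MathematicalPhysics.QuantumFieldTheory.MirrorRPKernel

/-!
# Skeleton line `laplace-lightcone-bootstrap` for crux `HRP2Rigidity` (stmt-CriticalPhenomena-1979) — gen 2

Route `HyperoctahedralRP`, sub-problem `Ising3DConformalLimit`, crux r2 (the route's new mechanism):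
a continuous positive kernel `K` on `ℝ³∖{0}`, homogeneous of degree `-2Δ`, `1/2 ≤ Δ ≤ 1`, invariant and
reflection positive with respect to the nine `B₃` lattice mirrors `n ∈ {eᵢ, eᵢ ± eⱼ}`, is `O(3)`-invariant.
Crux-plan skeleton, generation 2 (planner `cruxplan-stmt-CriticalPhenomena-1979-laplace-lightcone-bo-g2`; idea card
`Cruxes/HRP2Rigidity/Ideas/laplace-lightcone-bootstrap.md`, merged by the triage panel with
`landau-pinning-residual-annulus`): SIX registered stubs `stub_*` (sorried) and the kernel-checked composition
`HRP2Rigidity_of`, whose conclusion is literally the route decl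
`Summit.CriticalPhenomena.Ising3DConformalLimit.Theses.HyperoctahedralRP.HRP2Rigidity`.

## What changed relative to generation 1 (same file, 2026-08-16T00:59Z, 5 stubs)

* The LOCAL step is now its own stub `stub_localAnalyticity` (S3, NEW): representing measures + oblique spokes
  ⟹ `K` is real-analytic on `ℝ³ ∖ {0}` (x-space: Laplace–Fourier integrals over a neighbourhood of the origin
  of the transverse plane; the card's `diamondLemma`). Triage r1-3 asked for exactly this regularity stub ahead
  of any k-space step, and the standing disprover's blueprint `GlobalStep-a1.md` names it as the only residual gap
  of the `Δ = 1/2` endpoint ("`K` continuous does not by itself make `C` continuous"). It is L-sized and provable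
  now, so it is a third early work package next to S1 (vendor) and S2.
* `stub_rigidityHalf` (S4) is RE-CUT accordingly: it takes `AnalyticOnNhd ℝ K {0}ᶜ` in place of the spokes and is
  now exactly "dictionary + GlobalStep-a1": under LOCAL, the nine representing measures make every pencil of
  `K̂ = ‖k‖⁻² C(k̂)` a finite Stieltjes transform and the disprover's leaf monotonicity closes. Same name, new
  (shorter) signature; the other four registered stubs are byte-identical to generation 1.
* The negative-side tools are IMPORTED from the landed `Theorems/HRP2Rigidity/Negative/LoadBearing.lean`
  (`even_of_coordinate_mirrors`, `footpoint_bound`) instead of being re-proved locally (the farm now builds the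
  module), and `Negative/Descent.lean` (landed: `leafPhi_antitone`, `leaf_round_of_Phi_eq`, `hrp2Rigidity_descent`,
  `rp_mul`) is imported so that S4's prover has the `a = 1` leaf tools in scope.
* New proved milestone `rigidityAtHalf_of_stubs`: S1 ∧ S2 ∧ S3 ∧ S4 ⟹ the crux body at `Δ = 1/2` — the endpoint
  closes without touching the two open stubs.

## The line in one paragraph (x-space, measure currency)

Reflection positivity in the direction `n` makes `K` on the open half-space `⟪x,n⟫ > 0` the
Laplace–Fourier transform of a positive measure `μ_n(dλ, dξ)` on `[0,∞) × n^⊥`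
(`K(x) = ∫ e^{-λ⟪x,n̂⟫} cos⟪ξ,x⟫ dμ_n`; BCR Thm 4.2.8 / Glimm–Jaffe Thm 6.2.4; boundedness on shifted
half-spaces comes from the landed foot-point bound `Negative.footpoint_bound`) — `stub_laplaceRep`.
The set of transverse directions `y ⊥ n` with `∫ e^{-λt + ⟪ξ,y⟫} dμ_n < ∞` is a CONVEX body `t·B_n`
(Hölder), `K` is holomorphic on the tube over it, and every real boundary point of `B_n` is a genuine
singularity (Landau–Widder / Lukacs).  SEEDS (`stub_obliqueSeeds`, the x-side two-pole lemma = card 5's 2D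
Landau lemma): for every OBLIQUE partner mirror `m` (`⟪m,n⟫ ≠ 0`, `m ∦ n`) the frame-`m` continuation, made
two-dimensional on the bipolar plane `span(n,m)` by complex homogeneity, covers the frame-`n` Landau segment
`t n̂ + iσ ê`, `|σ| < t`, so `μ_n` has all exponential moments along `±ê` up to order `t`: the axis bodies
contain the diamond `|y₁|+|y₂| < 1`, the diagonal bodies a hexagon of in-radius `√(2/3)`.  LOCAL
(`stub_localAnalyticity`): moments near `y = 0` in the three axis frames make `K` real-analytic off the origin.
BOOTSTRAP (`stub_lightConeBootstrap`, THE HARDEST STUB, the line's lever): the nine tubes live in nine real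
structures of `ℂ³`, the tube of one pole covers door lines of the others, and the monotone iteration
"body → tube → cross-frame Landau certification (+ analytic discs) → larger body" should drive both bodies to the
unit disc, i.e. `supp μ_n ⊂ {λ ≥ ‖ξ‖}` for all nine `n` — the forward-light-cone spectral condition (L).
ENDGAME.  At the endpoint `Δ = 1/2` (`a = 1`) the bootstrap is NOT needed: LOCAL gives `K̂ = ‖k‖⁻²C(k̂)` with `C`
smooth, the representing measures make every pencil a finite Stieltjes transform, and the standing disprover's
`a = 1` leaf monotonicity (`GlobalStep-a1.md`, `Negative.leafPhi_antitone`, `Negative.leaf_round_of_Phi_eq`;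
monotone for EVERY positive pencil measure, spacelike mass or not) closes the crux — `stub_rigidityHalf`, provable
now.  For `1/2 < Δ ≤ 1` (`stub_rigidityAboveHalf`) (L) deletes every equatorial wall, makes all 13 bipolar great
circles rigid and reduces the crux to a bounded-phase Liouville problem for `log C` off the nine families of POLAR
slits (Disproof.lean F12's `V_R`-question in its nonlinear, `|Im| ≤ π` form) — open; this and (L) itself are the
two open stubs, and both are consumed by the composition only on the half-open window.

## Disproof used (Cruxes/HRP2Rigidity/Disproof.lean, gen-2 cycle 2, F1–F13; landed `Negative/LoadBearing.lean`,
`Negative/Descent.lean` — both imported here)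

* `hrp2Rigidity_false_without_RP` (RP load-bearing): honoured — RP enters at `stub_laplaceRep` (the
  Laplace–Fourier representation IS reflection positivity) and, through the representing measures, every later
  stub; the composition feeds the RP conjunct of all nine normals into `stub_laplaceRep` via `laplaceRep_of_crux`.
* `footpoint_bound` / `rp_two_point` ("all that `m ≤ 2` gives; a proof must use `m ≥ 3`"): USED BY NAME, and only
  for what it is worth — boundedness of `K` on `{⟪x,n̂⟫ ≥ t}` (hypothesis of BCR 4.2.8) in `laplaceRep_of_crux`; the
  spectral side (all `m`) is `stub_laplaceRep`.
* `even_of_coordinate_mirrors`: USED BY NAME for the half-space symmetry `K(p - θq) = K(q - θp)`.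
* F4 dead families (quadrics, finite harmonic content, polynomial shadows, `1+εP₄`, algebraic kernels, …): no stub
  asserts finite harmonic content, a polynomial shadow or an algebraic singular locus.
* F9/F10 + `GlobalStep-a1.md` (GLOBAL step at `a = 1` solved by leaf monotonicity, conditional ONLY on the
  LOCAL/dictionary step; diagonal fans suffice): this IS the plan of `stub_rigidityHalf`, and its stated residual gap
  (continuity of `C`) IS `stub_localAnalyticity`; the Lean cores `leafPhi_antitone` / `leaf_round_of_Phi_eq` are in
  scope through the `Negative.Descent` import.
* F11/F12 (no leafwise maximum principle for `a < 1`; the timelike tangent space `V_R`): `stub_rigidityAboveHalf` is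
  exactly the statement F12 says is open; a non-constant `H ∈ V_R` would refute it (and the crux on `(1/2,1]`) while
  leaving `stub_lightConeBootstrap` intact — the S5/S6 split is the disprover's dichotomy "spacelike mass (kills S5)
  vs. bounded-phase polar-slit singularities (kills S6)"; either way the counterexample lives at `Δ > 1/2`.
* F13 (log-convexity of the admissible profile class `𝒜(a)`, closure under `C ↦ C^θ`, `θ ≤ 1`): consistent with the
  cut — none of the closure operations creates spacelike mass or polar-slit singularities from round data, so neither
  open stub has a cheap counterexample; recorded in the line card as the reason the falsifier of S5 must be a genuinely
  new seed (F7), searched by the LP programme F8 at `Δ = 1`.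
* Δ-monotonicity `Negative.hrp2Rigidity_descent` (Schur descent): not used in the composition (it would trade
  `stub_rigidityHalf` for nine-mirror RP of `‖x‖⁻¹`, Frank–Lieb Lemma 2.1, not in the tree); it is why `Δ = 1` is
  the weakest point of `stub_rigidityAboveHalf`.
* `ledger negatives --problem CriticalPhenomena` (8 entries, 2026-08-16): none concerns two-point kernels / mirror
  RP; no stub is an instance of a refuted statement.  No `¬ stub` is derivable from the landed Negative files (the
  witness `(Σxᵢ⁴)/(Σxᵢ²)³` is not RP for the diagonal mirrors and has no Laplace–Fourier representation there).
-/

noncomputable section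

open scoped BigOperators InnerProductSpace

namespace Summit.CriticalPhenomena.Ising3DConformalLimit.Cruxes.HRP2Rigidity.LaplaceLightconeBootstrap

open Literature.MathematicalPhysics.QuantumFieldTheory
open Summit.CriticalPhenomena.Ising3DConformalLimit.Theorems.HRP2Rigidity.Negative
  (even_of_coordinate_mirrors footpoint_bound)

/-! ### Vocabulary of the line (three transparent definitions; the registered stub signatures below
spell them out over tree declarations only) -/

/-- `μ` is a LAPLACE–FOURIER REPRESENTING MEASURE of the kernel `K` in the frame of the (nonzero, not
necessarily unit) normal `n`: a positive measure on `ℝ × ℝ³` concentrated on `{(λ, ξ) : λ ≥ 0, ξ ⊥ n}`, with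
`∫ e^{-λt} dμ < ∞` for every `t > 0`, such that on the OPEN half-space
`K x = ∫ e^{-λ ⟪x,n⟫/‖n‖} cos ⟪ξ, x⟫ dμ(λ, ξ)` (BCR Thm 4.2.8 / §4.4; the x-space Källén–Lehmann form). -/
def IsLaplaceRep (n : EuclideanSpace ℝ (Fin 3)) (K : EuclideanSpace ℝ (Fin 3) → ℝ)
    (μ : MeasureTheory.Measure (ℝ × EuclideanSpace ℝ (Fin 3))) : Prop :=
  (∀ᵐ p ∂μ, 0 ≤ p.1 ∧ inner ℝ p.2 n = 0) ∧
  (∀ t : ℝ, 0 < t →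
    MeasureTheory.Integrable (fun p : ℝ × EuclideanSpace ℝ (Fin 3) => Real.exp (-(p.1 * t))) μ) ∧
  (∀ x : EuclideanSpace ℝ (Fin 3), 0 < inner ℝ x n →
    K x = ∫ p, Real.exp (-(p.1 * (inner ℝ x n / ‖n‖))) * Real.cos (inner ℝ p.2 x) ∂μ)

/-- FORWARD-LIGHT-CONE SUPPORT of a representing measure: `λ ≥ ‖ξ‖` almost everywhere ("no spacelike
Källén–Lehmann mass"; equivalently `K` is holomorphic on the light-cone tube `{|⟪Re z,n̂⟫| > ‖P_{n^⊥} Im z‖}`). -/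
def IsForwardCone (μ : MeasureTheory.Measure (ℝ × EuclideanSpace ℝ (Fin 3))) : Prop :=
  ∀ᵐ p ∂μ, ‖p.2‖ ≤ p.1

/-- SPOKES of the Laplace-convergence body of `μ` (frame `n`) toward the mirror normal `m`: all exponential
moments `∫ e^{-λt + s⟪ξ,m⟫} dμ` are finite as long as `|s|·‖P_{n^⊥} m‖ < t`, i.e. the body `t·B_n` contains the
open segment of length `2t` in the direction of the projection `P_{n^⊥} m = m - (⟪m,n⟫/‖n‖²) n`. -/
def HasSpokes (n m : EuclideanSpace ℝ (Fin 3)) (μ : MeasureTheory.Measure (ℝ × EuclideanSpace ℝ (Fin 3))) :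
    Prop :=
  ∀ t s : ℝ, |s| * ‖m - (inner ℝ m n / ‖n‖ ^ 2) • n‖ < t →
    MeasureTheory.Integrable
      (fun p : ℝ × EuclideanSpace ℝ (Fin 3) => Real.exp (-(p.1 * t) + s * inner ℝ p.2 m)) μ

/-! ### The six stub STATEMENTS (named; each is followed below by its registered stub, spelled out) -/

/-- **S1. LaplaceRepresentation** (Berg–Christensen–Ressel Thm 4.2.8 + §4.4 / Glimm–Jaffe Thm 6.2.4,
x-space form; a vendorable literature FACT).  A kernel on `ℝ³` which, for a nonzero normal `n`, is continuous
on the open half-space, mirror-RP for `n` (finite point configurations), symmetric on the half-space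
(`K(p - θq) = K(q - θp)`) and bounded on every shifted half-space `{⟪x,n⟫/‖n‖ ≥ t}`, `t > 0`, has a
Laplace–Fourier representing measure in the frame `n`. -/
def LaplaceRepresentation : Prop :=
  ∀ (n : EuclideanSpace ℝ (Fin 3)) (K : EuclideanSpace ℝ (Fin 3) → ℝ), n ≠ 0 →
    ContinuousOn K {x | 0 < inner ℝ x n} →
    (∀ (m : ℕ) (p : Fin m → EuclideanSpace ℝ (Fin 3)) (c : Fin m → ℝ), (∀ a, 0 < inner ℝ (p a) n) →
      0 ≤ ∑ a, ∑ b, c a * c b * K (p a - ((ℝ ∙ n)ᗮ).reflection (p b))) →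
    (∀ p q : EuclideanSpace ℝ (Fin 3), 0 < inner ℝ p n → 0 < inner ℝ q n →
      K (p - ((ℝ ∙ n)ᗮ).reflection q) = K (q - ((ℝ ∙ n)ᗮ).reflection p)) →
    (∀ t : ℝ, 0 < t → ∃ C : ℝ, ∀ x : EuclideanSpace ℝ (Fin 3), t ≤ inner ℝ x n / ‖n‖ → |K x| ≤ C) →
    ∃ μ : MeasureTheory.Measure (ℝ × EuclideanSpace ℝ (Fin 3)), IsLaplaceRep n K μ

/-- **S2. ObliqueSeeds** (x-side two-pole lemma; the 2D Landau lemma of card landau-pinning-residual-annulus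
lifted to the bipolar planes).  Under the hypotheses of the crux, if every one of the nine normals carries a
representing measure, then for every pair `n, m` of the nine with `⟪m,n⟫ ≠ 0`, `m ≠ ±n`, every representing
measure of frame `n` has spokes toward `m`. -/
def ObliqueSeeds : Prop :=
  ∀ (Δ : ℝ) (K : EuclideanSpace ℝ (Fin 3) → ℝ), 1/2 ≤ Δ → Δ ≤ 1 → ContinuousOn K {0}ᶜ →
    (∀ x, x ≠ 0 → 0 < K x) → (∀ c : ℝ, 0 < c → ∀ x, K (c • x) = c ^ (-(2 * Δ)) * K x) →
    (∀ n : EuclideanSpace ℝ (Fin 3), (∃ i j : Fin 3, i ≠ j ∧ (n = EuclideanSpace.single i 1 ∨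
        n = EuclideanSpace.single i 1 + EuclideanSpace.single j 1 ∨
        n = EuclideanSpace.single i 1 - EuclideanSpace.single j 1)) →
      (∀ x, K (((ℝ ∙ n)ᗮ).reflection x) = K x) ∧
      (∀ (m : ℕ) (p : Fin m → EuclideanSpace ℝ (Fin 3)) (c : Fin m → ℝ), (∀ a, 0 < inner ℝ (p a) n) →
        0 ≤ ∑ a, ∑ b, c a * c b * K (p a - ((ℝ ∙ n)ᗮ).reflection (p b)))) →
    (∀ n : EuclideanSpace ℝ (Fin 3), (∃ i j : Fin 3, i ≠ j ∧ (n = EuclideanSpace.single i 1 ∨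
        n = EuclideanSpace.single i 1 + EuclideanSpace.single j 1 ∨
        n = EuclideanSpace.single i 1 - EuclideanSpace.single j 1)) →
      ∃ μ : MeasureTheory.Measure (ℝ × EuclideanSpace ℝ (Fin 3)), IsLaplaceRep n K μ) →
    ∀ n m : EuclideanSpace ℝ (Fin 3),
      (∃ i j : Fin 3, i ≠ j ∧ (n = EuclideanSpace.single i 1 ∨
        n = EuclideanSpace.single i 1 + EuclideanSpace.single j 1 ∨
        n = EuclideanSpace.single i 1 - EuclideanSpace.single j 1)) →
      (∃ i j : Fin 3, i ≠ j ∧ (m = EuclideanSpace.single i 1 ∨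
        m = EuclideanSpace.single i 1 + EuclideanSpace.single j 1 ∨
        m = EuclideanSpace.single i 1 - EuclideanSpace.single j 1)) →
      inner ℝ m n ≠ 0 → m ≠ n → m ≠ -n →
      ∀ μ : MeasureTheory.Measure (ℝ × EuclideanSpace ℝ (Fin 3)), IsLaplaceRep n K μ → HasSpokes n m μ

/-- **S3. LocalAnalyticity** — the LOCAL step, NEW in gen 2 (x-space; the card's `diamondLemma` in its natural
generality; provable now).  Under the hypotheses of the crux, if all nine frames carry representing measures and
all oblique pairs have spokes (S2), then `K` is real-analytic on `ℝ³ ∖ {0}`.  (Spokes of the axis frame `eᵢ`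
toward `eⱼ ± eᵢ` give the exponential moments `∫ e^{-λt + σ|ξⱼ|} dμ < ∞`, `σ < t`; by `e^{a+b} ≤ (e^{2a}+e^{2b})/2`
all moments `∫ e^{-λt + ⟪ξ,y⟫} dμ`, `|yⱼ|, |yₖ| < t/2`, are finite, so the Laplace–Fourier integral is a convergent
power series around every real point of the open half-space `xᵢ > 0`; evenness covers `xᵢ < 0`, and the three
axis half-space pairs cover `ℝ³ ∖ {0}`.)  This closes the residual gap of `GlobalStep-a1.md` ("`K` continuous
does not by itself make `C` continuous") and is the regularity stub triage r1-3 asked for. -/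
def LocalAnalyticity : Prop :=
  ∀ (Δ : ℝ) (K : EuclideanSpace ℝ (Fin 3) → ℝ), 1/2 ≤ Δ → Δ ≤ 1 → ContinuousOn K {0}ᶜ →
    (∀ x, x ≠ 0 → 0 < K x) → (∀ c : ℝ, 0 < c → ∀ x, K (c • x) = c ^ (-(2 * Δ)) * K x) →
    (∀ n : EuclideanSpace ℝ (Fin 3), (∃ i j : Fin 3, i ≠ j ∧ (n = EuclideanSpace.single i 1 ∨
        n = EuclideanSpace.single i 1 + EuclideanSpace.single j 1 ∨
        n = EuclideanSpace.single i 1 - EuclideanSpace.single j 1)) →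
      (∀ x, K (((ℝ ∙ n)ᗮ).reflection x) = K x) ∧
      (∀ (m : ℕ) (p : Fin m → EuclideanSpace ℝ (Fin 3)) (c : Fin m → ℝ), (∀ a, 0 < inner ℝ (p a) n) →
        0 ≤ ∑ a, ∑ b, c a * c b * K (p a - ((ℝ ∙ n)ᗮ).reflection (p b)))) →
    (∀ n : EuclideanSpace ℝ (Fin 3), (∃ i j : Fin 3, i ≠ j ∧ (n = EuclideanSpace.single i 1 ∨
        n = EuclideanSpace.single i 1 + EuclideanSpace.single j 1 ∨
        n = EuclideanSpace.single i 1 - EuclideanSpace.single j 1)) →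
      ∃ μ : MeasureTheory.Measure (ℝ × EuclideanSpace ℝ (Fin 3)), IsLaplaceRep n K μ) →
    (∀ n m : EuclideanSpace ℝ (Fin 3),
      (∃ i j : Fin 3, i ≠ j ∧ (n = EuclideanSpace.single i 1 ∨
        n = EuclideanSpace.single i 1 + EuclideanSpace.single j 1 ∨
        n = EuclideanSpace.single i 1 - EuclideanSpace.single j 1)) →
      (∃ i j : Fin 3, i ≠ j ∧ (m = EuclideanSpace.single i 1 ∨
        m = EuclideanSpace.single i 1 + EuclideanSpace.single j 1 ∨
        m = EuclideanSpace.single i 1 - EuclideanSpace.single j 1)) →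
      inner ℝ m n ≠ 0 → m ≠ n → m ≠ -n →
      ∀ μ : MeasureTheory.Measure (ℝ × EuclideanSpace ℝ (Fin 3)), IsLaplaceRep n K μ → HasSpokes n m μ) →
    AnalyticOnNhd ℝ K {0}ᶜ

/-- **S4. RigidityAtHalf** — the endpoint `Δ = 1/2` (`a = 1`), RE-CUT in gen 2, PROVABLE NOW (paper proof on
file).  A continuous positive kernel, homogeneous of degree `-1`, nine-mirror invariant and RP, REAL-ANALYTIC off
the origin (S3) and carrying representing measures in the nine frames (S1), is `O(3)`-invariant.  (Dictionary:
`K ∈ C^ω(ℝ³∖0)` homogeneous of degree `-1` ⟹ `K̂ = ‖k‖⁻² C(k̂)` with `C ∈ C^∞(S²)`, `O_h`-invariant, and the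
representing measures make every pencil `s ↦ K̂(√s n̂ + u)` a finite Stieltjes transform with mass `C(n̂)`; then
the standing disprover's `a = 1` leaf monotonicity `GlobalStep-a1.md`.  No light-cone support and no spokes are
assumed.) -/
def RigidityAtHalf : Prop :=
  ∀ (Δ : ℝ) (K : EuclideanSpace ℝ (Fin 3) → ℝ), Δ = 1/2 → ContinuousOn K {0}ᶜ →
    (∀ x, x ≠ 0 → 0 < K x) → (∀ c : ℝ, 0 < c → ∀ x, K (c • x) = c ^ (-(2 * Δ)) * K x) →
    (∀ n : EuclideanSpace ℝ (Fin 3), (∃ i j : Fin 3, i ≠ j ∧ (n = EuclideanSpace.single i 1 ∨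
        n = EuclideanSpace.single i 1 + EuclideanSpace.single j 1 ∨
        n = EuclideanSpace.single i 1 - EuclideanSpace.single j 1)) →
      (∀ x, K (((ℝ ∙ n)ᗮ).reflection x) = K x) ∧
      (∀ (m : ℕ) (p : Fin m → EuclideanSpace ℝ (Fin 3)) (c : Fin m → ℝ), (∀ a, 0 < inner ℝ (p a) n) →
        0 ≤ ∑ a, ∑ b, c a * c b * K (p a - ((ℝ ∙ n)ᗮ).reflection (p b)))) →
    AnalyticOnNhd ℝ K {0}ᶜ →
    (∀ n : EuclideanSpace ℝ (Fin 3), (∃ i j : Fin 3, i ≠ j ∧ (n = EuclideanSpace.single i 1 ∨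
        n = EuclideanSpace.single i 1 + EuclideanSpace.single j 1 ∨
        n = EuclideanSpace.single i 1 - EuclideanSpace.single j 1)) →
      ∃ μ : MeasureTheory.Measure (ℝ × EuclideanSpace ℝ (Fin 3)), IsLaplaceRep n K μ) →
    ∀ (R : EuclideanSpace ℝ (Fin 3) ≃ₗᵢ[ℝ] EuclideanSpace ℝ (Fin 3)) (x : EuclideanSpace ℝ (Fin 3)),
      K (R x) = K x

/-- **S5. LightConeBootstrap** — (L), THE HARDEST STUB (open; consumed only on `1/2 < Δ ≤ 1`).  Under the
hypotheses of the crux, if all nine frames carry representing measures and all oblique pairs have spokes (S2),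
then every representing measure of every one of the nine frames is supported in the closed forward light cone
`{λ ≥ ‖ξ‖}`.  (Unchanged from gen 1.) -/
def LightConeBootstrap : Prop :=
  ∀ (Δ : ℝ) (K : EuclideanSpace ℝ (Fin 3) → ℝ), 1/2 ≤ Δ → Δ ≤ 1 → ContinuousOn K {0}ᶜ →
    (∀ x, x ≠ 0 → 0 < K x) → (∀ c : ℝ, 0 < c → ∀ x, K (c • x) = c ^ (-(2 * Δ)) * K x) →
    (∀ n : EuclideanSpace ℝ (Fin 3), (∃ i j : Fin 3, i ≠ j ∧ (n = EuclideanSpace.single i 1 ∨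
        n = EuclideanSpace.single i 1 + EuclideanSpace.single j 1 ∨
        n = EuclideanSpace.single i 1 - EuclideanSpace.single j 1)) →
      (∀ x, K (((ℝ ∙ n)ᗮ).reflection x) = K x) ∧
      (∀ (m : ℕ) (p : Fin m → EuclideanSpace ℝ (Fin 3)) (c : Fin m → ℝ), (∀ a, 0 < inner ℝ (p a) n) →
        0 ≤ ∑ a, ∑ b, c a * c b * K (p a - ((ℝ ∙ n)ᗮ).reflection (p b)))) →
    (∀ n : EuclideanSpace ℝ (Fin 3), (∃ i j : Fin 3, i ≠ j ∧ (n = EuclideanSpace.single i 1 ∨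
        n = EuclideanSpace.single i 1 + EuclideanSpace.single j 1 ∨
        n = EuclideanSpace.single i 1 - EuclideanSpace.single j 1)) →
      ∃ μ : MeasureTheory.Measure (ℝ × EuclideanSpace ℝ (Fin 3)), IsLaplaceRep n K μ) →
    (∀ n m : EuclideanSpace ℝ (Fin 3),
      (∃ i j : Fin 3, i ≠ j ∧ (n = EuclideanSpace.single i 1 ∨
        n = EuclideanSpace.single i 1 + EuclideanSpace.single j 1 ∨
        n = EuclideanSpace.single i 1 - EuclideanSpace.single j 1)) →
      (∃ i j : Fin 3, i ≠ j ∧ (m = EuclideanSpace.single i 1 ∨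
        m = EuclideanSpace.single i 1 + EuclideanSpace.single j 1 ∨
        m = EuclideanSpace.single i 1 - EuclideanSpace.single j 1)) →
      inner ℝ m n ≠ 0 → m ≠ n → m ≠ -n →
      ∀ μ : MeasureTheory.Measure (ℝ × EuclideanSpace ℝ (Fin 3)), IsLaplaceRep n K μ → HasSpokes n m μ) →
    ∀ n : EuclideanSpace ℝ (Fin 3), (∃ i j : Fin 3, i ≠ j ∧ (n = EuclideanSpace.single i 1 ∨
        n = EuclideanSpace.single i 1 + EuclideanSpace.single j 1 ∨
        n = EuclideanSpace.single i 1 - EuclideanSpace.single j 1)) →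
      ∀ μ : MeasureTheory.Measure (ℝ × EuclideanSpace ℝ (Fin 3)), IsLaplaceRep n K μ → IsForwardCone μ

/-- **S6. RigidityAboveHalf** — (C⁺) on the half-open window `1/2 < Δ ≤ 1` (`1/2 ≤ a < 1`).  A nine-RP kernel of
the crux, homogeneous of degree `-2Δ`, `1/2 < Δ ≤ 1`, all of whose nine frames carry a forward-light-cone
supported representing measure, is `O(3)`-invariant.  Open; under (L) equivalent to a bounded-phase Liouville
theorem for `log C` off the nine polar-slit families (13 rigid bipolar circles for free).  (Unchanged from gen 1.) -/
def RigidityAboveHalf : Prop :=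
  ∀ (Δ : ℝ) (K : EuclideanSpace ℝ (Fin 3) → ℝ), 1/2 < Δ → Δ ≤ 1 → ContinuousOn K {0}ᶜ →
    (∀ x, x ≠ 0 → 0 < K x) → (∀ c : ℝ, 0 < c → ∀ x, K (c • x) = c ^ (-(2 * Δ)) * K x) →
    (∀ n : EuclideanSpace ℝ (Fin 3), (∃ i j : Fin 3, i ≠ j ∧ (n = EuclideanSpace.single i 1 ∨
        n = EuclideanSpace.single i 1 + EuclideanSpace.single j 1 ∨
        n = EuclideanSpace.single i 1 - EuclideanSpace.single j 1)) →
      (∀ x, K (((ℝ ∙ n)ᗮ).reflection x) = K x) ∧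
      (∀ (m : ℕ) (p : Fin m → EuclideanSpace ℝ (Fin 3)) (c : Fin m → ℝ), (∀ a, 0 < inner ℝ (p a) n) →
        0 ≤ ∑ a, ∑ b, c a * c b * K (p a - ((ℝ ∙ n)ᗮ).reflection (p b)))) →
    (∀ n : EuclideanSpace ℝ (Fin 3), (∃ i j : Fin 3, i ≠ j ∧ (n = EuclideanSpace.single i 1 ∨
        n = EuclideanSpace.single i 1 + EuclideanSpace.single j 1 ∨
        n = EuclideanSpace.single i 1 - EuclideanSpace.single j 1)) →
      ∃ μ : MeasureTheory.Measure (ℝ × EuclideanSpace ℝ (Fin 3)), IsLaplaceRep n K μ ∧ IsForwardCone μ) →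
    ∀ (R : EuclideanSpace ℝ (Fin 3) ≃ₗᵢ[ℝ] EuclideanSpace ℝ (Fin 3)) (x : EuclideanSpace ℝ (Fin 3)),
      K (R x) = K x

/-! ### Registered stubs (signatures spelled out over tree declarations only: Mathlib + the route decls) -/

/-- **stub_laplaceRep** (S1; size XL as a Lean proof, but a vendorable literature FACT: Berg–Christensen–Ressel,
*Harmonic Analysis on Semigroups* (GTM 100, 1984) Thm 4.2.8 + §4.4; Glimm–Jaffe, *Quantum Physics* (1987)
Thm 6.2.4; Osterwalder–Schrader 1973 §4).  Reading: `φ(t, y) := K(t n̂ + y)`, `y ⊥ n`, is positive definite on the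
`*`-semigroup `(0,∞) × n^⊥`, `(t,y)* = (t,-y)` (this IS the RP conjunct: `pₐ - θ p_b = (tₐ+t_b) n̂ + (yₐ-y_b)`;
complex coefficients by the symmetry hypothesis, cf. `IsMirrorRPKernel.isPosSemidefKernelOn`); for each `t₀ > 0`
the shift `φ(t+t₀, y)` is bounded, continuous and positive definite on the semigroup WITH identity
`[0,∞) × n^⊥`, hence (BCR 4.2.8; continuity kills the degenerate semicharacter `1_{t=0}` and non-measurable
characters of `n^⊥`) `φ(t+t₀,y) = ∫ e^{-λt} e^{i⟪ξ,y⟫} dμ_{t₀}`, `λ ≥ 0`, `ξ ⊥ n`; `μ := e^{λt₀} μ_{t₀}` is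
`t₀`-independent by uniqueness; realness gives the cosine form.  (Equivalently: OS reconstruction — the shifts
`(s,y)`, `s ≥ 0`, act on the RP pre-Hilbert space as a symmetric contraction semigroup times a unitary group; joint
spectral measure of the vector `δ_{εn̂}`.)  Why plausibly true: TRUE (classical Källén–Lehmann / OS two-point
representation).  Mathlib has neither Bochner's theorem on `ℝ²` nor Bernstein–Widder (tree:
`Literature.Analysis.SpecialFunctions.IsStieltjesFunction`, real-variable only); the recommended move is to VENDOR
this statement as a cited `Literature/Analysis/HarmonicAnalysis` fact and re-cut the line with it as a hypothesis
(lead's reshape), not to prove it from scratch.  Same content as `stub_laplaceRepresentation` of the line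
wall-jump-edge-of-the-wedge (that one takes the crux hypotheses directly); one vendored fact serves both. -/
theorem stub_laplaceRep :
    ∀ (n : EuclideanSpace ℝ (Fin 3)) (K : EuclideanSpace ℝ (Fin 3) → ℝ), n ≠ 0 →
      ContinuousOn K {x | 0 < inner ℝ x n} →
      (∀ (m : ℕ) (p : Fin m → EuclideanSpace ℝ (Fin 3)) (c : Fin m → ℝ), (∀ a, 0 < inner ℝ (p a) n) →
        0 ≤ ∑ a, ∑ b, c a * c b * K (p a - ((ℝ ∙ n)ᗮ).reflection (p b))) →
      (∀ p q : EuclideanSpace ℝ (Fin 3), 0 < inner ℝ p n → 0 < inner ℝ q n →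
        K (p - ((ℝ ∙ n)ᗮ).reflection q) = K (q - ((ℝ ∙ n)ᗮ).reflection p)) →
      (∀ t : ℝ, 0 < t → ∃ C : ℝ, ∀ x : EuclideanSpace ℝ (Fin 3), t ≤ inner ℝ x n / ‖n‖ → |K x| ≤ C) →
      ∃ μ : MeasureTheory.Measure (ℝ × EuclideanSpace ℝ (Fin 3)),
        (∀ᵐ p ∂μ, 0 ≤ p.1 ∧ inner ℝ p.2 n = 0) ∧
        (∀ t : ℝ, 0 < t →
          MeasureTheory.Integrable (fun p : ℝ × EuclideanSpace ℝ (Fin 3) => Real.exp (-(p.1 * t))) μ) ∧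
        (∀ x : EuclideanSpace ℝ (Fin 3), 0 < inner ℝ x n →
          K x = ∫ p, Real.exp (-(p.1 * (inner ℝ x n / ‖n‖))) * Real.cos (inner ℝ p.2 x) ∂μ) := by
  sorry

/-- **stub_obliqueSeeds** (S2; size L; PROVABLE NOW — the first certified foothold of the line).  For a nine-RP
kernel of the crux, a frame `n`, an oblique partner `m` (`⟪m,n⟫ ≠ 0`, `m ≠ ±n`) and any representing measure
`μ` of frame `n`: `∫ e^{-λt + s⟪ξ,m⟫} dμ < ∞` whenever `|s|·‖m - (⟪m,n⟫/‖n‖²)n‖ < t`.  Proof plan (card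
landau-pinning 2D lemma, verified by triage r1-2/r1-3 step by step; gen-2 precision on the branch): WLOG
`⟪m,n⟫ > 0` (replace `m` by `-m`: same mirror; RP/invariance transfer by evenness); orthonormal frame of the
bipolar plane `P = span(n,m)`: `m̂ = cos α n̂ + sin α ê`, `v̂ = sin α n̂ - cos α ê`, `0 < α < π/2`;
(i) frame-`m` representation (hypothesis, for `m`): for REAL `b > 0` the slice `k(a,b) = K(a m̂ + b v̂)` is the
Laplace integral `∫ e^{-λ'a} cos(…) dμ_m`, holomorphic in `a` on `Re a > 0`, and real homogeneity gives
`k(a,b) = b^{-2Δ} g(a/b)` with `g := k(·,1)` holomorphic on the right half-plane; (ii) so `F(a,b) := b^{-2Δ} g(a/b)`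
(principal branch) is a SINGLE-VALUED holomorphic function of two variables on the simply connected domain
`{Re b > 0, Re(a b̄) > 0}`, equal to `K` at its real points; the frame-`n` Landau path `s ↦ z(s) = t n̂ + s ê`
has `a(s) = t cos α + s sin α`, `b(s) = t sin α - s cos α`, hence for `s = iσ`: `Re b = t sin α > 0` and
`Re(a b̄) = ½ sin 2α (t² - σ²) > 0` for `|σ| < t` — the whole segment lies in the domain, so
`G(s) := F(a(s), b(s))` is holomorphic on a neighbourhood of `{iσ : |σ| < t} ∪ {0}` and equals `K(t n̂ + s ê)` for
small real `s`; (iii) frame-`n` representation: for real `s`, `K(t n̂ + s ê) = ∫ cos(su) dν_t(u)` is the cosine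
transform of the finite positive measure `ν_t` = push-forward of `e^{-λt}dμ` under `(λ,ξ) ↦ ⟪ξ,ê⟫`; by Lukacs,
*Characteristic Functions*, Thm 7.1.1 (a ch.f. regular near `0` is regular in a maximal horizontal strip whose
purely imaginary boundary points are singular; = Landau–Widder II.5b) and the identity theorem along the segment,
the strip half-width is `≥ t`, i.e. `∫ e^{σ|u|} dν_t < ∞` for `σ < t`, which is the conclusion
(`⟪ξ,m⟫ = ‖P_{n^⊥}m‖⟪ξ,ê⟫` for `ξ ⊥ n`; only the symmetrisation of `ν_t` is determined, but `e^{σ|u|}` is even).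
Needs in Lean: the 1D Landau–Lukacs singularity theorem for cosine transforms of positive measures (M, not in
Mathlib: prove via Pringsheim/Vivanti on the even power series with nonnegative even coefficients), holomorphy of
parameter integrals (`hasDerivAt_integral_of_dominated_loc_of_deriv_le`), identity theorem
(`AnalyticOnNhd.eqOn_of_preconnected_of_eventuallyEq`), and the pushforward bookkeeping.  Why it might fail: it
does not on paper; the Lean risk is the two-variable holomorphy/identity bookkeeping of step (ii). -/
theorem stub_obliqueSeeds :
    ∀ (Δ : ℝ) (K : EuclideanSpace ℝ (Fin 3) → ℝ), 1/2 ≤ Δ → Δ ≤ 1 → ContinuousOn K {0}ᶜ →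
      (∀ x, x ≠ 0 → 0 < K x) → (∀ c : ℝ, 0 < c → ∀ x, K (c • x) = c ^ (-(2 * Δ)) * K x) →
      (∀ n : EuclideanSpace ℝ (Fin 3), (∃ i j : Fin 3, i ≠ j ∧ (n = EuclideanSpace.single i 1 ∨
          n = EuclideanSpace.single i 1 + EuclideanSpace.single j 1 ∨
          n = EuclideanSpace.single i 1 - EuclideanSpace.single j 1)) →
        (∀ x, K (((ℝ ∙ n)ᗮ).reflection x) = K x) ∧
        (∀ (m : ℕ) (p : Fin m → EuclideanSpace ℝ (Fin 3)) (c : Fin m → ℝ), (∀ a, 0 < inner ℝ (p a) n) →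
          0 ≤ ∑ a, ∑ b, c a * c b * K (p a - ((ℝ ∙ n)ᗮ).reflection (p b)))) →
      (∀ n : EuclideanSpace ℝ (Fin 3), (∃ i j : Fin 3, i ≠ j ∧ (n = EuclideanSpace.single i 1 ∨
          n = EuclideanSpace.single i 1 + EuclideanSpace.single j 1 ∨
          n = EuclideanSpace.single i 1 - EuclideanSpace.single j 1)) →
        ∃ μ : MeasureTheory.Measure (ℝ × EuclideanSpace ℝ (Fin 3)),
          (∀ᵐ p ∂μ, 0 ≤ p.1 ∧ inner ℝ p.2 n = 0) ∧
          (∀ t : ℝ, 0 < t →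
            MeasureTheory.Integrable (fun p : ℝ × EuclideanSpace ℝ (Fin 3) => Real.exp (-(p.1 * t))) μ) ∧
          (∀ x : EuclideanSpace ℝ (Fin 3), 0 < inner ℝ x n →
            K x = ∫ p, Real.exp (-(p.1 * (inner ℝ x n / ‖n‖))) * Real.cos (inner ℝ p.2 x) ∂μ)) →
      ∀ n m : EuclideanSpace ℝ (Fin 3),
        (∃ i j : Fin 3, i ≠ j ∧ (n = EuclideanSpace.single i 1 ∨
          n = EuclideanSpace.single i 1 + EuclideanSpace.single j 1 ∨
          n = EuclideanSpace.single i 1 - EuclideanSpace.single j 1)) →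
        (∃ i j : Fin 3, i ≠ j ∧ (m = EuclideanSpace.single i 1 ∨
          m = EuclideanSpace.single i 1 + EuclideanSpace.single j 1 ∨
          m = EuclideanSpace.single i 1 - EuclideanSpace.single j 1)) →
        inner ℝ m n ≠ 0 → m ≠ n → m ≠ -n →
        ∀ μ : MeasureTheory.Measure (ℝ × EuclideanSpace ℝ (Fin 3)),
          ((∀ᵐ p ∂μ, 0 ≤ p.1 ∧ inner ℝ p.2 n = 0) ∧
            (∀ t : ℝ, 0 < t →
              MeasureTheory.Integrable (fun p : ℝ × EuclideanSpace ℝ (Fin 3) => Real.exp (-(p.1 * t))) μ) ∧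
            (∀ x : EuclideanSpace ℝ (Fin 3), 0 < inner ℝ x n →
              K x = ∫ p, Real.exp (-(p.1 * (inner ℝ x n / ‖n‖))) * Real.cos (inner ℝ p.2 x) ∂μ)) →
          ∀ t s : ℝ, |s| * ‖m - (inner ℝ m n / ‖n‖ ^ 2) • n‖ < t →
            MeasureTheory.Integrable
              (fun p : ℝ × EuclideanSpace ℝ (Fin 3) => Real.exp (-(p.1 * t) + s * inner ℝ p.2 m)) μ := by
  sorry

/-- **stub_localAnalyticity** (S3, NEW in gen 2; size L; PROVABLE NOW — the LOCAL step of the route in x-space).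
For a nine-RP kernel of the crux with representing measures in all nine frames and the oblique spokes of S2, `K` is
real-analytic on `ℝ³ ∖ {0}`.  Proof plan: fix `x₀ ≠ 0`, pick `i` with `x₀ᵢ ≠ 0`; by evenness
(`Negative.even_of_coordinate_mirrors`, analyticity transported through `x ↦ -x`) assume `t₀ := x₀ᵢ > 0`.  Frame
`n = eᵢ`, representing measure `μ` (hypothesis), spokes toward `m = eⱼ + eᵢ` and `m = eₖ + eᵢ` (oblique:
`⟪m,n⟫ = 1`, `P_{n^⊥}m = eⱼ` resp. `eₖ`, unit length): `∫ e^{-λt ± sξⱼ} dμ`, `∫ e^{-λt ± sξₖ} dμ < ∞` for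
`|s| < t`.  With `ℓ_{λ,ξ}(h) := -λhᵢ + i(ξⱼhⱼ + ξₖhₖ)` (linear in `h ∈ ℝ³`, note `ξ ⊥ eᵢ` a.e.) the representation
reads `K(x₀ + h) = Re ∫ e^{ℓ(x₀)} e^{ℓ(h)} dμ` for small `h`, and `e^{ℓ(h)} = Σ_k ℓ(h)^k/k!`; the `k`-th term is a
continuous `k`-linear map in `h` with operator norm `≤ ∫ e^{-λt₀}(λ+|ξⱼ|+|ξₖ|)^k/k! dμ ≤ r^{-k} ∫ e^{-λ(t₀-r)}
e^{r|ξⱼ|} e^{r|ξₖ|} dμ ≤ r^{-k} · ½(∫e^{-λ(t₀-r)+2r|ξⱼ|} + ∫e^{-λ(t₀-r)+2r|ξₖ|}) < ∞` for `3r < t₀` (AM–GM and the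
spokes), so the series is a `FormalMultilinearSeries` with radius `≥ r` and `HasFPowerSeriesOnBall K p x₀ r`
(dominated convergence for the interchange).  Why plausibly true: TRUE (Laplace transforms are analytic in the
interior of their convergence tube; here only a neighbourhood of the real point is needed, so no convexity/Hölder
argument is required).  Lean cost: building the multilinear series from the integral and the norm bounds (Mathlib:
`ContinuousMultilinearMap.mkPiRing`-type constructors, `HasFPowerSeriesOnBall`, `MeasureTheory.integral_tsum` /
dominated convergence); no mathematical risk.  Used by the composition at `Δ = 1/2` (feeds S4); S5/S6 provers may
call it too (its hypotheses are theirs). -/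
theorem stub_localAnalyticity :
    ∀ (Δ : ℝ) (K : EuclideanSpace ℝ (Fin 3) → ℝ), 1/2 ≤ Δ → Δ ≤ 1 → ContinuousOn K {0}ᶜ →
      (∀ x, x ≠ 0 → 0 < K x) → (∀ c : ℝ, 0 < c → ∀ x, K (c • x) = c ^ (-(2 * Δ)) * K x) →
      (∀ n : EuclideanSpace ℝ (Fin 3), (∃ i j : Fin 3, i ≠ j ∧ (n = EuclideanSpace.single i 1 ∨
          n = EuclideanSpace.single i 1 + EuclideanSpace.single j 1 ∨
          n = EuclideanSpace.single i 1 - EuclideanSpace.single j 1)) →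
        (∀ x, K (((ℝ ∙ n)ᗮ).reflection x) = K x) ∧
        (∀ (m : ℕ) (p : Fin m → EuclideanSpace ℝ (Fin 3)) (c : Fin m → ℝ), (∀ a, 0 < inner ℝ (p a) n) →
          0 ≤ ∑ a, ∑ b, c a * c b * K (p a - ((ℝ ∙ n)ᗮ).reflection (p b)))) →
      (∀ n : EuclideanSpace ℝ (Fin 3), (∃ i j : Fin 3, i ≠ j ∧ (n = EuclideanSpace.single i 1 ∨
          n = EuclideanSpace.single i 1 + EuclideanSpace.single j 1 ∨
          n = EuclideanSpace.single i 1 - EuclideanSpace.single j 1)) →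
        ∃ μ : MeasureTheory.Measure (ℝ × EuclideanSpace ℝ (Fin 3)),
          (∀ᵐ p ∂μ, 0 ≤ p.1 ∧ inner ℝ p.2 n = 0) ∧
          (∀ t : ℝ, 0 < t →
            MeasureTheory.Integrable (fun p : ℝ × EuclideanSpace ℝ (Fin 3) => Real.exp (-(p.1 * t))) μ) ∧
          (∀ x : EuclideanSpace ℝ (Fin 3), 0 < inner ℝ x n →
            K x = ∫ p, Real.exp (-(p.1 * (inner ℝ x n / ‖n‖))) * Real.cos (inner ℝ p.2 x) ∂μ)) →
      (∀ n m : EuclideanSpace ℝ (Fin 3),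
        (∃ i j : Fin 3, i ≠ j ∧ (n = EuclideanSpace.single i 1 ∨
          n = EuclideanSpace.single i 1 + EuclideanSpace.single j 1 ∨
          n = EuclideanSpace.single i 1 - EuclideanSpace.single j 1)) →
        (∃ i j : Fin 3, i ≠ j ∧ (m = EuclideanSpace.single i 1 ∨
          m = EuclideanSpace.single i 1 + EuclideanSpace.single j 1 ∨
          m = EuclideanSpace.single i 1 - EuclideanSpace.single j 1)) →
        inner ℝ m n ≠ 0 → m ≠ n → m ≠ -n →
        ∀ μ : MeasureTheory.Measure (ℝ × EuclideanSpace ℝ (Fin 3)),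
          ((∀ᵐ p ∂μ, 0 ≤ p.1 ∧ inner ℝ p.2 n = 0) ∧
            (∀ t : ℝ, 0 < t →
              MeasureTheory.Integrable (fun p : ℝ × EuclideanSpace ℝ (Fin 3) => Real.exp (-(p.1 * t))) μ) ∧
            (∀ x : EuclideanSpace ℝ (Fin 3), 0 < inner ℝ x n →
              K x = ∫ p, Real.exp (-(p.1 * (inner ℝ x n / ‖n‖))) * Real.cos (inner ℝ p.2 x) ∂μ)) →
          ∀ t s : ℝ, |s| * ‖m - (inner ℝ m n / ‖n‖ ^ 2) • n‖ < t →
            MeasureTheory.Integrable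
              (fun p : ℝ × EuclideanSpace ℝ (Fin 3) => Real.exp (-(p.1 * t) + s * inner ℝ p.2 m)) μ) →
      AnalyticOnNhd ℝ K {0}ᶜ := by
  sorry

/-- **stub_rigidityHalf** (S4; RE-CUT in gen 2; size XL in Lean — the k-space dictionary is the cost; PROVABLE NOW
ON PAPER: `Cruxes/HRP2Rigidity/GlobalStep-a1.md` (standing disprover, 2026-08-16) under exactly the regularity
hypothesis supplied here by S3).  At `Δ = 1/2`, a crux kernel that is real-analytic off the origin and carries
representing measures in the nine frames is isotropic.  Proof plan: (i) DICTIONARY: `K ∈ C^ω(ℝ³∖0) ⊂ C^∞`,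
homogeneous of degree `-1`, is locally integrable and tempered; `K̂` is `C^∞` off `0` (Hörmander Thm 7.1.18),
homogeneous of degree `-2`, with no part supported at the origin (degree `-2 ≠ -3 - k`, Hörmander Thm 3.2.3), so
`K̂ = ‖k‖⁻² C(k̂)` with `C ∈ C^∞(S²)`, even and `O_h`-invariant (all nine mirror invariances commute with `𝓕`);
Fourier transforming `e^{-λ|t|} ↦ 2λ/(λ² + k_n²)` in the frame-`n` representation (pairing against `φ₁(k_n)φ₂(q)`;
at `Δ = 1/2` the `λ → 0` end needs the Tauberian `μ_n{λ ≤ ε} = O(ε)` from `K(t n̂) = c t⁻¹`, or a difference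
quotient in `t`) shows that for every test function `χ ≥ 0` on `n^⊥` the map `s ↦ ∫ K̂(√s n̂ + q) χ(q) dq` is a
Stieltjes function `∫ dρ_χ(σ)/(s+σ)` (`σ = λ²`); letting `χ → δ_u` (continuity of `C`, closedness of the Stieltjes
cone under pointwise limits — tree predicate `Literature.Analysis.SpecialFunctions.IsStieltjesFunction`) every pencil
`f(s) = K̂(√s n̂ + u) = C(k̂(s))/(1+s)`, `‖u‖ = 1`, `u ⊥ n`, is Stieltjes, with `a = b = 0` in `a/s + b + ∫dρ/(s+σ)`,
finite mass `ρ(ℝ₊) = lim s f(s) = C(n̂)` and `∫dρ/σ = f(0⁺) = C(u) < ∞`; (ii) GLOBAL (`GlobalStep-a1.md`, Disproof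
F9): `Φ(s) := (1+s)(C(k̂(s)) - C(n̂)) = ∫ (1+s)(1-σ)/(s+σ) dρ` satisfies
`Φ(s) - Φ(t) = (t-s) ∫ (1-σ)²/((s+σ)(t+σ)) dρ ≥ 0` (`Negative.leaf_kernel_identity`; finite form
`Negative.leafPhi_antitone`, equality case `Negative.leaf_round_of_Phi_eq`; the measure versions are the same
computation under `∫`), so Φ is non-increasing on every leaf of every fan with equality only for round leaves;
Step 1 poles are global maxima (`C ≤ c₀`), Step 2 the circle `{k₃ = 0}` (leaf of `d = (e₁+e₂)/√2` through `d'`,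
passing `e₁` at `s = 1`) is round, Step 3 sweeping the leaves of `P = (e₁+e₃)/√2` across `{k₃ = 0}` makes every
leaf with `v₃ ≠ 0` round, so `C ≡ c₀` on `S² ∖ {k₁ = k₃}`, hence everywhere by continuity; (iii) `K̂ = c₀‖k‖⁻²`
⟹ `K = c₀'/‖x‖` (injectivity of `𝓕` on tempered distributions, both sides locally integrable functions) ⟹
`K ∘ R = K`.  (F10: the six diagonal fans alone suffice.)  Why it might fail: it does not on paper (triage r1-2/r1-3
and the disprover checked the monotonicity independently); the Lean cost is the distributional Fourier transform of
a homogeneous kernel (`SchwartzMap.fourierTransformCLM`, Schwartz pairings as in the line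
bounded-phase-quadric-liouville's `IsFourierProfile.fourier`) — honest XL infrastructure, no mathematical risk.  If
the lead keeps both lines, step (i) here = `stub_dictionary` there restricted to `Δ = 1/2` (with analyticity of `C`
downgraded to continuity) and step (ii)+(iii) = `stub_monotoneEndpoint` + `stub_fourierUniqueness` there. -/
theorem stub_rigidityHalf :
    ∀ (Δ : ℝ) (K : EuclideanSpace ℝ (Fin 3) → ℝ), Δ = 1/2 → ContinuousOn K {0}ᶜ →
      (∀ x, x ≠ 0 → 0 < K x) → (∀ c : ℝ, 0 < c → ∀ x, K (c • x) = c ^ (-(2 * Δ)) * K x) →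
      (∀ n : EuclideanSpace ℝ (Fin 3), (∃ i j : Fin 3, i ≠ j ∧ (n = EuclideanSpace.single i 1 ∨
          n = EuclideanSpace.single i 1 + EuclideanSpace.single j 1 ∨
          n = EuclideanSpace.single i 1 - EuclideanSpace.single j 1)) →
        (∀ x, K (((ℝ ∙ n)ᗮ).reflection x) = K x) ∧
        (∀ (m : ℕ) (p : Fin m → EuclideanSpace ℝ (Fin 3)) (c : Fin m → ℝ), (∀ a, 0 < inner ℝ (p a) n) →
          0 ≤ ∑ a, ∑ b, c a * c b * K (p a - ((ℝ ∙ n)ᗮ).reflection (p b)))) →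
      AnalyticOnNhd ℝ K {0}ᶜ →
      (∀ n : EuclideanSpace ℝ (Fin 3), (∃ i j : Fin 3, i ≠ j ∧ (n = EuclideanSpace.single i 1 ∨
          n = EuclideanSpace.single i 1 + EuclideanSpace.single j 1 ∨
          n = EuclideanSpace.single i 1 - EuclideanSpace.single j 1)) →
        ∃ μ : MeasureTheory.Measure (ℝ × EuclideanSpace ℝ (Fin 3)),
          (∀ᵐ p ∂μ, 0 ≤ p.1 ∧ inner ℝ p.2 n = 0) ∧
          (∀ t : ℝ, 0 < t →
            MeasureTheory.Integrable (fun p : ℝ × EuclideanSpace ℝ (Fin 3) => Real.exp (-(p.1 * t))) μ) ∧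
          (∀ x : EuclideanSpace ℝ (Fin 3), 0 < inner ℝ x n →
            K x = ∫ p, Real.exp (-(p.1 * (inner ℝ x n / ‖n‖))) * Real.cos (inner ℝ p.2 x) ∂μ)) →
      ∀ (R : EuclideanSpace ℝ (Fin 3) ≃ₗᵢ[ℝ] EuclideanSpace ℝ (Fin 3)) (x : EuclideanSpace ℝ (Fin 3)),
        K (R x) = K x := by
  sorry

/-- **stub_lightConeBootstrap** (S5 = (L); size XL; OPEN — the load-bearing stub and the line's lever; the
composition consumes it only for `1/2 < Δ ≤ 1`; unchanged from gen 1).  For a nine-RP kernel of the crux, every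
representing measure of every one of the nine frames is supported in the closed forward light cone `λ ≥ ‖ξ‖`, GIVEN
representing measures in all nine frames and the oblique spokes of S2.
Mechanism (idea card + landau-pinning, sharpened by triage): the Laplace-convergence body
`B_n(t) = {y ⊥ n : ∫ e^{-λt+⟪ξ,y⟫} dμ_n < ∞} = t·B_n(1)` is CONVEX (Hölder; Cuppens 1975 Thm 3.3.1–3.3.2) — so the
spokes give `B_axis ⊇ diamond` (in-radius `1/√2`), `B_diag ⊇ hexagon` (in-radius `√(2/3)`, vertices `±τ`,
`(±τ ± √2 e_k)/√3`); `K` is holomorphic on the tube `{x+iy : |⟪x,n̂⟫| > gauge_{B_n}(P_n y)}` (Cuppens 3.3.1) and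
every real boundary point of `B_n` is SINGULAR (Landau–Widder restricted to segments from interior points; triage
r1-2 checked the multivariate reduction); a boundary candidate `n̂ + iη` certified holomorphic by ANOTHER frame's
tube (same branch: plain tubes meet in convex sets containing real points — automatic; saturated/disc extensions
need the path-connectivity check each time, triage r1-2 CAVEAT) therefore lies inside `B_n`: monotone set-valued
iteration on the pair (axis body, diagonal body).  Certified so far: plain tubes reach the fixed point in ONE step,
axis body radial `1.000@0°, 0.866@15°, 0.812@30°, 0.8165@45°` (min `0.807`), diagonal body `0.8165@90°` (toward
`e₃`) — kit j007689 / triage r1-2 `out_pure_720.json`; with the other eight bodies IDEAL the axis Landau set is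
exactly `E₁ ∪ E₂ = {η₂²+2η₃²<1} ∪ {2η₂²+η₃²<1}` (stall theorem of landau-pinning, confirmed to 4 decimals by triage
r1-1 toy A, kit j007680); Kontinuitätssatz discs in the chart `Φ(ψ,ω)` lift the certified radius to `0.9165`
(card, kit j005941; branch agreement NOT yet checked for discs).  OPEN CORE: the lens
`{0.8165 ≤ |η| < 1}` around the twelve 2-fold directions (`(±e₂±e₃)/√2` in the frame of `e₁`; `±e₃` in the
diagonal frames), where only a PERPENDICULAR pair of mirrors acts; internal barrier B1 (card): tubes + LOCAL discs
cannot clear the six perpendicular-bipolar door lines to infinite height (coverage would need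
`1 - ⟪n_j, e₃×d⟩² > 1`), so the height-∞ closure needs a new ingredient (off-centre/elliptic discs or annuli,
plane-section conics through the door point, or a softer closure statement).  Why it might fail: a pair of
positive homogeneous measures `(μ_{e₃}, μ_d)` with spacelike mass at slopes `κ ∈ (0.82, 1)` within a few degrees
of the 2-fold directions, compatible as germs of one `K` and passing the nine leafwise Hankel tests, would make the
limit body genuinely smaller than the disc (card's Cheapest falsifier; cdisprove's LP search F8 hunts exactly
there, at `Δ = 1`; by F13 no closure operation manufactures such mass from round data — the enemy is a genuinely
new seed, F7).  Since the crux implies (L) (the round kernel's frame measures are Lorentz invariant, and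
representing measures are unique up to `ξ ↦ -ξ` symmetrisation, under which the cone condition is invariant), a
kernel breaking this stub inside the window is a counterexample to the crux itself; at `Δ = 1/2` the stub is a
COROLLARY of S1–S4 (not used there by the composition). -/
theorem stub_lightConeBootstrap :
    ∀ (Δ : ℝ) (K : EuclideanSpace ℝ (Fin 3) → ℝ), 1/2 ≤ Δ → Δ ≤ 1 → ContinuousOn K {0}ᶜ →
      (∀ x, x ≠ 0 → 0 < K x) → (∀ c : ℝ, 0 < c → ∀ x, K (c • x) = c ^ (-(2 * Δ)) * K x) →
      (∀ n : EuclideanSpace ℝ (Fin 3), (∃ i j : Fin 3, i ≠ j ∧ (n = EuclideanSpace.single i 1 ∨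
          n = EuclideanSpace.single i 1 + EuclideanSpace.single j 1 ∨
          n = EuclideanSpace.single i 1 - EuclideanSpace.single j 1)) →
        (∀ x, K (((ℝ ∙ n)ᗮ).reflection x) = K x) ∧
        (∀ (m : ℕ) (p : Fin m → EuclideanSpace ℝ (Fin 3)) (c : Fin m → ℝ), (∀ a, 0 < inner ℝ (p a) n) →
          0 ≤ ∑ a, ∑ b, c a * c b * K (p a - ((ℝ ∙ n)ᗮ).reflection (p b)))) →
      (∀ n : EuclideanSpace ℝ (Fin 3), (∃ i j : Fin 3, i ≠ j ∧ (n = EuclideanSpace.single i 1 ∨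
          n = EuclideanSpace.single i 1 + EuclideanSpace.single j 1 ∨
          n = EuclideanSpace.single i 1 - EuclideanSpace.single j 1)) →
        ∃ μ : MeasureTheory.Measure (ℝ × EuclideanSpace ℝ (Fin 3)),
          (∀ᵐ p ∂μ, 0 ≤ p.1 ∧ inner ℝ p.2 n = 0) ∧
          (∀ t : ℝ, 0 < t →
            MeasureTheory.Integrable (fun p : ℝ × EuclideanSpace ℝ (Fin 3) => Real.exp (-(p.1 * t))) μ) ∧
          (∀ x : EuclideanSpace ℝ (Fin 3), 0 < inner ℝ x n →
            K x = ∫ p, Real.exp (-(p.1 * (inner ℝ x n / ‖n‖))) * Real.cos (inner ℝ p.2 x) ∂μ)) →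
      (∀ n m : EuclideanSpace ℝ (Fin 3),
        (∃ i j : Fin 3, i ≠ j ∧ (n = EuclideanSpace.single i 1 ∨
          n = EuclideanSpace.single i 1 + EuclideanSpace.single j 1 ∨
          n = EuclideanSpace.single i 1 - EuclideanSpace.single j 1)) →
        (∃ i j : Fin 3, i ≠ j ∧ (m = EuclideanSpace.single i 1 ∨
          m = EuclideanSpace.single i 1 + EuclideanSpace.single j 1 ∨
          m = EuclideanSpace.single i 1 - EuclideanSpace.single j 1)) →
        inner ℝ m n ≠ 0 → m ≠ n → m ≠ -n →
        ∀ μ : MeasureTheory.Measure (ℝ × EuclideanSpace ℝ (Fin 3)),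
          ((∀ᵐ p ∂μ, 0 ≤ p.1 ∧ inner ℝ p.2 n = 0) ∧
            (∀ t : ℝ, 0 < t →
              MeasureTheory.Integrable (fun p : ℝ × EuclideanSpace ℝ (Fin 3) => Real.exp (-(p.1 * t))) μ) ∧
            (∀ x : EuclideanSpace ℝ (Fin 3), 0 < inner ℝ x n →
              K x = ∫ p, Real.exp (-(p.1 * (inner ℝ x n / ‖n‖))) * Real.cos (inner ℝ p.2 x) ∂μ)) →
          ∀ t s : ℝ, |s| * ‖m - (inner ℝ m n / ‖n‖ ^ 2) • n‖ < t →
            MeasureTheory.Integrable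
              (fun p : ℝ × EuclideanSpace ℝ (Fin 3) => Real.exp (-(p.1 * t) + s * inner ℝ p.2 m)) μ) →
      ∀ n : EuclideanSpace ℝ (Fin 3), (∃ i j : Fin 3, i ≠ j ∧ (n = EuclideanSpace.single i 1 ∨
          n = EuclideanSpace.single i 1 + EuclideanSpace.single j 1 ∨
          n = EuclideanSpace.single i 1 - EuclideanSpace.single j 1)) →
        ∀ μ : MeasureTheory.Measure (ℝ × EuclideanSpace ℝ (Fin 3)),
          ((∀ᵐ p ∂μ, 0 ≤ p.1 ∧ inner ℝ p.2 n = 0) ∧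
            (∀ t : ℝ, 0 < t →
              MeasureTheory.Integrable (fun p : ℝ × EuclideanSpace ℝ (Fin 3) => Real.exp (-(p.1 * t))) μ) ∧
            (∀ x : EuclideanSpace ℝ (Fin 3), 0 < inner ℝ x n →
              K x = ∫ p, Real.exp (-(p.1 * (inner ℝ x n / ‖n‖))) * Real.cos (inner ℝ p.2 x) ∂μ)) →
          ∀ᵐ p ∂μ, ‖p.2‖ ≤ p.1 := by
  sorry

/-- **stub_rigidityAboveHalf** (S6; size XL; OPEN — the second open stub, shared terrain with the crux ideas
bounded-phase-quadric-liouville / causal-commutator-spin-bound / positivity-domain-envelope; unchanged from gen 1).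
For `1/2 < Δ ≤ 1` (`a = 3/2 - Δ ∈ [1/2, 1)`) forward-light-cone support in all nine frames forces isotropy.  What
(L) buys (the Transfer's gain, k-space, F1/F11/F12 of Disproof.lean): LOCAL is free (light-cone tubes), and on
every leaf of every fan the profile `G(w) = C(k̂)`, `w = cos 2ψ`, has NO jump across the equatorial wall `w > 1`,
so `G ∈ 𝒪(ℂ ∖ (-∞,-1-δ])`, `F = (1+w)^a G` is Pick, `G` is zero-free with `arg G ∈ [-πa, π-πa]`; hence `H := log C`
is a real-analytic `O_h`-invariant function on `S²` all of whose leaf continuations are holomorphic off the POLAR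
slits `{Re ψ ∈ π/2 + πℤ, |Im ψ| ≥ η₀}` with `|Im H| ≤ π` — and the stub is EQUIVALENT (given LOCAL) to the
Liouville statement "such an `H` is constant".  Free consequences: all 13 bipolar great circles (3 coordinate, 6 of
type `kᵢ = ±kⱼ` — perpendicular pole pairs, NOT rigid without (L) — and 4 hexagonal) are rigid, since two fans'
polar slit sets on a shared circle are disjoint (F12 (i)); the remaining problem is propagation into the 2-cells of
the 13-circle net.  Why it might fail: Disproof F12 — if the LINEAR space `V_R` (bounded-holomorphic off the polar
slits, `O_h`-invariant, real-analytic) contains a non-constant `H`, then `‖x‖^{-2Δ}(1 + εK_H)` is an anisotropic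
nine-RP kernel SATISFYING (L) for every `Δ ∈ (1/2, 1]`, refuting this stub and the crux on the half-open window
while S1–S5 stand; `V_R = ℝ` is rated "plausible but unproved" (numerical null-space probe lin9rp).  Weakest point
`Δ = 1` (Schur descent `Negative.hrp2Rigidity_descent`).  Companion inputs that would close it: one-frame causality
+ Dyson/JLD mode classification (card causal-commutator-spin-bound: `m ≤ 2Δ - 1 < 2` ⇒ axial symmetry), or a
certified analytic-disc family through the 45° lens points (card positivity-domain-envelope), or the bounded-phase
line's `globalConstant_of_nineLeafEntire` once the polar walls are shown removable. -/
theorem stub_rigidityAboveHalf :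
    ∀ (Δ : ℝ) (K : EuclideanSpace ℝ (Fin 3) → ℝ), 1/2 < Δ → Δ ≤ 1 → ContinuousOn K {0}ᶜ →
      (∀ x, x ≠ 0 → 0 < K x) → (∀ c : ℝ, 0 < c → ∀ x, K (c • x) = c ^ (-(2 * Δ)) * K x) →
      (∀ n : EuclideanSpace ℝ (Fin 3), (∃ i j : Fin 3, i ≠ j ∧ (n = EuclideanSpace.single i 1 ∨
          n = EuclideanSpace.single i 1 + EuclideanSpace.single j 1 ∨
          n = EuclideanSpace.single i 1 - EuclideanSpace.single j 1)) →
        (∀ x, K (((ℝ ∙ n)ᗮ).reflection x) = K x) ∧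
        (∀ (m : ℕ) (p : Fin m → EuclideanSpace ℝ (Fin 3)) (c : Fin m → ℝ), (∀ a, 0 < inner ℝ (p a) n) →
          0 ≤ ∑ a, ∑ b, c a * c b * K (p a - ((ℝ ∙ n)ᗮ).reflection (p b)))) →
      (∀ n : EuclideanSpace ℝ (Fin 3), (∃ i j : Fin 3, i ≠ j ∧ (n = EuclideanSpace.single i 1 ∨
          n = EuclideanSpace.single i 1 + EuclideanSpace.single j 1 ∨
          n = EuclideanSpace.single i 1 - EuclideanSpace.single j 1)) →
        ∃ μ : MeasureTheory.Measure (ℝ × EuclideanSpace ℝ (Fin 3)),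
          ((∀ᵐ p ∂μ, 0 ≤ p.1 ∧ inner ℝ p.2 n = 0) ∧
            (∀ t : ℝ, 0 < t →
              MeasureTheory.Integrable (fun p : ℝ × EuclideanSpace ℝ (Fin 3) => Real.exp (-(p.1 * t))) μ) ∧
            (∀ x : EuclideanSpace ℝ (Fin 3), 0 < inner ℝ x n →
              K x = ∫ p, Real.exp (-(p.1 * (inner ℝ x n / ‖n‖))) * Real.cos (inner ℝ p.2 x) ∂μ)) ∧
          (∀ᵐ p ∂μ, ‖p.2‖ ≤ p.1)) →
      ∀ (R : EuclideanSpace ℝ (Fin 3) ≃ₗᵢ[ℝ] EuclideanSpace ℝ (Fin 3)) (x : EuclideanSpace ℝ (Fin 3)),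
        K (R x) = K x := by
  sorry

/-! ### Consistency: each named statement IS its registered stub (definitionally) -/

theorem laplaceRepresentation_holds : LaplaceRepresentation := stub_laplaceRep
theorem obliqueSeeds_holds : ObliqueSeeds := stub_obliqueSeeds
theorem localAnalyticity_holds : LocalAnalyticity := stub_localAnalyticity
theorem rigidityAtHalf_holds : RigidityAtHalf := stub_rigidityHalf
theorem lightConeBootstrap_holds : LightConeBootstrap := stub_lightConeBootstrap
theorem rigidityAboveHalf_holds : RigidityAboveHalf := stub_rigidityAboveHalf

/-! ### Name-keyed aliases of the six statements (the hypotheses of the composition)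

`__Registered.stub_X` is statement `X` under the registered stub's short name, so that the native skeleton audit
reads the hypotheses of `HRP2Rigidity_of` as the registered stubs BY NAME (admissibility is keyed on the last name
component).  The namespace carries the implementation-detail prefix `__` so that audits and reports resolve the
short name `stub_X` to the sorried THEOREM, never to the alias (gen-1's plain `Registered` aliases were picked up
by the skeleton report as `signature: Prop, sorried: false`). -/
namespace __Registered

/-- Alias of `LaplaceRepresentation` keyed by the registered stub name. -/
abbrev stub_laplaceRep : Prop := LaplaceRepresentation
/-- Alias of `ObliqueSeeds` keyed by the registered stub name. -/
abbrev stub_obliqueSeeds : Prop := ObliqueSeeds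
/-- Alias of `LocalAnalyticity` keyed by the registered stub name. -/
abbrev stub_localAnalyticity : Prop := LocalAnalyticity
/-- Alias of `RigidityAtHalf` keyed by the registered stub name. -/
abbrev stub_rigidityHalf : Prop := RigidityAtHalf
/-- Alias of `LightConeBootstrap` keyed by the registered stub name. -/
abbrev stub_lightConeBootstrap : Prop := LightConeBootstrap
/-- Alias of `RigidityAboveHalf` keyed by the registered stub name. -/
abbrev stub_rigidityAboveHalf : Prop := RigidityAboveHalf

end __Registered

/-! ### Glue (proved): the crux hypotheses deliver the hypotheses of BCR 4.2.8 in every one of the nine frames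

Uses the LANDED negative-side tools `Negative.even_of_coordinate_mirrors` (half-space symmetry) and
`Negative.footpoint_bound` (boundedness on shifted half-spaces — exactly and only what two-point RP gives), and the
mirror-RP API of `Literature.MathematicalPhysics.QuantumFieldTheory.MirrorRPKernel` (`smul_normal_iff`,
`mirrorReflection_smul_normal`, `mirrorKernel_symm_of_even`). -/

/-- The crux hypotheses on `K` (any `Δ > 0`) give, for each of the nine lattice normals `n`, the four hypotheses of
`LaplaceRepresentation`: continuity on the open half-space, RP, half-space symmetry, and the bound
`|K x| ≤ t^{-2Δ} K(n̂)` on `{⟪x,n⟫/‖n‖ ≥ t}` (foot-point bound for the unit normal `n̂ = ‖n‖⁻¹ n`). -/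
theorem laplaceRep_of_crux (h1 : LaplaceRepresentation) {Δ : ℝ} {K : EuclideanSpace ℝ (Fin 3) → ℝ}
    (hΔ : 0 < Δ) (hcont : ContinuousOn K {0}ᶜ) (hpos : ∀ x, x ≠ 0 → 0 < K x)
    (hhom : ∀ c : ℝ, 0 < c → ∀ x, K (c • x) = c ^ (-(2 * Δ)) * K x)
    (hnine : ∀ n : EuclideanSpace ℝ (Fin 3), (∃ i j : Fin 3, i ≠ j ∧ (n = EuclideanSpace.single i 1 ∨
        n = EuclideanSpace.single i 1 + EuclideanSpace.single j 1 ∨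
        n = EuclideanSpace.single i 1 - EuclideanSpace.single j 1)) →
      (∀ x, K (((ℝ ∙ n)ᗮ).reflection x) = K x) ∧
      (∀ (m : ℕ) (p : Fin m → EuclideanSpace ℝ (Fin 3)) (c : Fin m → ℝ), (∀ a, 0 < inner ℝ (p a) n) →
        0 ≤ ∑ a, ∑ b, c a * c b * K (p a - ((ℝ ∙ n)ᗮ).reflection (p b))))
    {n : EuclideanSpace ℝ (Fin 3)}
    (hn : ∃ i j : Fin 3, i ≠ j ∧ (n = EuclideanSpace.single i 1 ∨
        n = EuclideanSpace.single i 1 + EuclideanSpace.single j 1 ∨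
        n = EuclideanSpace.single i 1 - EuclideanSpace.single j 1)) :
    ∃ μ : MeasureTheory.Measure (ℝ × EuclideanSpace ℝ (Fin 3)), IsLaplaceRep n K μ := by
  have hn0 : n ≠ 0 := ne_zero_of_mem_latticeMirrorNormals (ι := Fin 3) hn
  have hinv : ∀ x, K ((ℝ ∙ n)ᗮ.reflection x) = K x := (hnine n hn).1
  have hRP := (hnine n hn).2
  have heven : ∀ x, K (-x) = K x := even_of_coordinate_mirrors (fun m hm => (hnine m hm).1)
  refine h1 n K hn0 ?_ hRP ?_ ?_
  · refine hcont.mono ?_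
    intro x hx h0
    have hx' : 0 < inner ℝ x n := hx
    have hx0 : x = 0 := h0
    rw [hx0, inner_zero_left] at hx'
    exact lt_irrefl _ hx'
  · intro p q _ _
    exact mirrorKernel_symm_of_even heven hinv p q
  · intro t ht
    have hnpos : 0 < ‖n‖ := norm_pos_iff.2 hn0
    set u : EuclideanSpace ℝ (Fin 3) := ‖n‖⁻¹ • n with hu_def
    have hu : ‖u‖ = 1 := by
      rw [hu_def, norm_smul, norm_inv, norm_norm, inv_mul_cancel₀ hnpos.ne']
    have hu0 : u ≠ 0 := by
      intro h
      rw [h, norm_zero] at hu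
      exact zero_ne_one hu
    have hinv_u : ∀ x, K ((ℝ ∙ u)ᗮ.reflection x) = K x := fun x => by
      rw [hu_def, mirrorReflection_smul_normal (inv_ne_zero hnpos.ne') n x]
      exact hinv x
    have hRP_u : ∀ (m : ℕ) (p : Fin m → EuclideanSpace ℝ (Fin 3)) (c : Fin m → ℝ),
        (∀ a, 0 < inner ℝ (p a) u) → 0 ≤ ∑ a, ∑ b, c a * c b * K (p a - ((ℝ ∙ u)ᗮ).reflection (p b)) :=
      (IsMirrorRPKernel.smul_normal_iff (K := K) (n := n) (inv_pos.2 hnpos)).2 hRP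
    have hKu : 0 ≤ K u := (hpos u hu0).le
    refine ⟨t ^ (-(2 * Δ)) * K u, fun z hz => ?_⟩
    have hzu : inner ℝ z u = inner ℝ z n / ‖n‖ := by
      rw [hu_def, real_inner_smul_right, div_eq_inv_mul]
    have hzu_ge : t ≤ inner ℝ z u := by rw [hzu]; exact hz
    have hzu_pos : 0 < ⟪z, u⟫_ℝ := lt_of_lt_of_le ht hzu_ge
    have hfp := footpoint_bound hu heven hinv_u hRP_u hhom hKu hzu_pos
    have hz0 : z ≠ 0 := by
      intro h
      rw [h, inner_zero_left] at hzu_pos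
      exact lt_irrefl _ hzu_pos
    have hKz : 0 < K z := hpos z hz0
    rw [abs_of_pos hKz]
    refine hfp.trans (mul_le_mul_of_nonneg_right ?_ hKu)
    exact Real.rpow_le_rpow_of_nonpos ht hzu_ge (by linarith)

/-! ### The composition: the six stubs imply the crux BY NAME -/

/-- **Composition.**  `stub_laplaceRep` (fed, in every one of the nine frames, by the crux hypotheses through
`laplaceRep_of_crux`) gives representing measures; `stub_obliqueSeeds` gives their oblique spokes.  At the
endpoint `Δ = 1/2`, `stub_localAnalyticity` makes `K` real-analytic off the origin and `stub_rigidityHalf`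
concludes (no open stub is touched).  On `1/2 < Δ ≤ 1`, `stub_lightConeBootstrap` upgrades the spokes to
forward-light-cone support (L) and `stub_rigidityAboveHalf` concludes `K ∘ R = K`. -/
theorem HRP2Rigidity_of (h1 : __Registered.stub_laplaceRep) (h2 : __Registered.stub_obliqueSeeds)
    (h3 : __Registered.stub_localAnalyticity) (h4 : __Registered.stub_rigidityHalf)
    (h5 : __Registered.stub_lightConeBootstrap) (h6 : __Registered.stub_rigidityAboveHalf) :
    Summit.CriticalPhenomena.Ising3DConformalLimit.Theses.HyperoctahedralRP.HRP2Rigidity := by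
  intro Δ K hlo hhi hcont hpos hhom hnine R x
  have hΔ : 0 < Δ := by linarith
  have hrep : ∀ n : EuclideanSpace ℝ (Fin 3), (∃ i j : Fin 3, i ≠ j ∧ (n = EuclideanSpace.single i 1 ∨
        n = EuclideanSpace.single i 1 + EuclideanSpace.single j 1 ∨
        n = EuclideanSpace.single i 1 - EuclideanSpace.single j 1)) →
      ∃ μ : MeasureTheory.Measure (ℝ × EuclideanSpace ℝ (Fin 3)), IsLaplaceRep n K μ :=
    fun n hn => laplaceRep_of_crux h1 hΔ hcont hpos hhom hnine hn
  have hspoke := h2 Δ K hlo hhi hcont hpos hhom hnine hrep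
  rcases hlo.eq_or_lt with heq | hlt
  · -- the endpoint Δ = 1/2: LOCAL (real-analyticity off 0) + dictionary + GlobalStep-a1
    have hloc : AnalyticOnNhd ℝ K {0}ᶜ := h3 Δ K hlo hhi hcont hpos hhom hnine hrep hspoke
    exact h4 Δ K heq.symm hcont hpos hhom hnine hloc hrep R x
  · -- the half-open window 1/2 < Δ ≤ 1: bootstrap to the light cone, then bounded-phase rigidity
    have hcone : ∀ n : EuclideanSpace ℝ (Fin 3), (∃ i j : Fin 3, i ≠ j ∧ (n = EuclideanSpace.single i 1 ∨
          n = EuclideanSpace.single i 1 + EuclideanSpace.single j 1 ∨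
          n = EuclideanSpace.single i 1 - EuclideanSpace.single j 1)) →
        ∃ μ : MeasureTheory.Measure (ℝ × EuclideanSpace ℝ (Fin 3)), IsLaplaceRep n K μ ∧ IsForwardCone μ := by
      intro n hn
      obtain ⟨μ, hμ⟩ := hrep n hn
      exact ⟨μ, hμ, h5 Δ K hlo hhi hcont hpos hhom hnine hrep hspoke n hn μ hμ⟩
    exact h6 Δ K hlt hhi hcont hpos hhom hnine hcone R x

/-- Wiring check: the registered stubs feed `HRP2Rigidity_of` as stated. -/
example : Summit.CriticalPhenomena.Ising3DConformalLimit.Theses.HyperoctahedralRP.HRP2Rigidity :=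
  HRP2Rigidity_of stub_laplaceRep stub_obliqueSeeds stub_localAnalyticity stub_rigidityHalf
    stub_lightConeBootstrap stub_rigidityAboveHalf

/-! ### Milestone inside the line (proved): the endpoint `Δ = 1/2` needs no open stub -/

/-- **Milestone `Δ = 1/2`.**  S1 ∧ S2 ∧ S3 ∧ S4 — a vendorable fact and three stubs rated provable now — already
give the crux body at the exponent `Δ = 1/2` (`a = 1`): two-point `O(3)` symmetry of every continuous positive
nine-mirror-RP kernel of degree `-1`.  (By `Negative.hrp2Rigidity_descent` the crux at `Δ = 1` would also imply
this, given nine-mirror RP of `‖x‖⁻¹`; the converse transport does not exist, which is why S5/S6 remain.) -/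
theorem rigidityAtHalf_of_stubs (h1 : __Registered.stub_laplaceRep) (h2 : __Registered.stub_obliqueSeeds)
    (h3 : __Registered.stub_localAnalyticity) (h4 : __Registered.stub_rigidityHalf) :
    ∀ (K : EuclideanSpace ℝ (Fin 3) → ℝ), ContinuousOn K {0}ᶜ → (∀ x, x ≠ 0 → 0 < K x) →
      (∀ c : ℝ, 0 < c → ∀ x, K (c • x) = c ^ (-(2 * (1 / 2 : ℝ))) * K x) →
      (∀ n : EuclideanSpace ℝ (Fin 3), (∃ i j : Fin 3, i ≠ j ∧ (n = EuclideanSpace.single i 1 ∨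
          n = EuclideanSpace.single i 1 + EuclideanSpace.single j 1 ∨
          n = EuclideanSpace.single i 1 - EuclideanSpace.single j 1)) →
        (∀ x, K (((ℝ ∙ n)ᗮ).reflection x) = K x) ∧
        (∀ (m : ℕ) (p : Fin m → EuclideanSpace ℝ (Fin 3)) (c : Fin m → ℝ), (∀ a, 0 < inner ℝ (p a) n) →
          0 ≤ ∑ a, ∑ b, c a * c b * K (p a - ((ℝ ∙ n)ᗮ).reflection (p b)))) →
      ∀ (R : EuclideanSpace ℝ (Fin 3) ≃ₗᵢ[ℝ] EuclideanSpace ℝ (Fin 3)) (x : EuclideanSpace ℝ (Fin 3)),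
        K (R x) = K x := by
  intro K hcont hpos hhom hnine R x
  have hlo : (1 / 2 : ℝ) ≤ 1 / 2 := le_rfl
  have hhi : (1 / 2 : ℝ) ≤ 1 := by norm_num
  have hΔ : (0 : ℝ) < 1 / 2 := by norm_num
  have hrep : ∀ n : EuclideanSpace ℝ (Fin 3), (∃ i j : Fin 3, i ≠ j ∧ (n = EuclideanSpace.single i 1 ∨
        n = EuclideanSpace.single i 1 + EuclideanSpace.single j 1 ∨
        n = EuclideanSpace.single i 1 - EuclideanSpace.single j 1)) →
      ∃ μ : MeasureTheory.Measure (ℝ × EuclideanSpace ℝ (Fin 3)), IsLaplaceRep n K μ :=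
    fun n hn => laplaceRep_of_crux h1 hΔ hcont hpos hhom hnine hn
  have hspoke := h2 (1 / 2) K hlo hhi hcont hpos hhom hnine hrep
  have hloc : AnalyticOnNhd ℝ K {0}ᶜ := h3 (1 / 2) K hlo hhi hcont hpos hhom hnine hrep hspoke
  exact h4 (1 / 2) K rfl hcont hpos hhom hnine hloc hrep R x

/-! ### A proved consistency lemma of the line: (L) implies every spoke (the bootstrap is monotone) -/

/-- Forward-light-cone support implies finiteness of ALL transverse exponential moments of order `< t`
(`e^{-λt + s⟪ξ,m⟫} ≤ e^{-λ(t - |s|‖P_{n^⊥}m‖)}` on the cone): the conclusion of S5 subsumes the conclusion of S2, as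
a monotone bootstrap must; in particular under (L) the hypotheses of S3 hold, so LOCAL is free on `(1/2, 1]`. -/
theorem hasSpokes_of_isForwardCone {n m : EuclideanSpace ℝ (Fin 3)} {K : EuclideanSpace ℝ (Fin 3) → ℝ}
    {μ : MeasureTheory.Measure (ℝ × EuclideanSpace ℝ (Fin 3))}
    (hrep : IsLaplaceRep n K μ) (hcone : IsForwardCone μ) : HasSpokes n m μ := by
  intro t s hst
  set v : EuclideanSpace ℝ (Fin 3) := m - (inner ℝ m n / ‖n‖ ^ 2) • n with hv_def
  have hvnn : 0 ≤ |s| * ‖v‖ := mul_nonneg (abs_nonneg _) (norm_nonneg _)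
  have ht : 0 < t := lt_of_le_of_lt hvnn hst
  set t' : ℝ := t - |s| * ‖v‖ with ht'_def
  have ht' : 0 < t' := by rw [ht'_def]; linarith
  have hint := hrep.2.1 t' ht'
  refine hint.mono' ?_ ?_
  · have hc : Continuous
        (fun p : ℝ × EuclideanSpace ℝ (Fin 3) => Real.exp (-(p.1 * t) + s * inner ℝ p.2 m)) :=
      Real.continuous_exp.comp
        (((continuous_fst.mul continuous_const).neg).add
          (continuous_const.mul (continuous_snd.inner continuous_const)))
    exact hc.aestronglyMeasurable
  · filter_upwards [hrep.1, hcone] with p hp hpc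
    rw [Real.norm_eq_abs, abs_of_pos (Real.exp_pos _)]
    refine Real.exp_le_exp.2 ?_
    -- ⟪ξ, m⟫ = ⟪ξ, v⟫ since ξ ⊥ n
    have hξ : inner ℝ p.2 m = inner ℝ p.2 v := by
      rw [hv_def, inner_sub_right, real_inner_smul_right, hp.2, mul_zero, sub_zero]
    have hcs : |inner ℝ p.2 v| ≤ ‖p.2‖ * ‖v‖ := abs_real_inner_le_norm _ _
    have h1 : s * inner ℝ p.2 m ≤ |s| * ‖v‖ * p.1 := by
      rw [hξ]
      calc s * inner ℝ p.2 v ≤ |s * inner ℝ p.2 v| := le_abs_self _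
        _ = |s| * |inner ℝ p.2 v| := abs_mul _ _
        _ ≤ |s| * (‖p.2‖ * ‖v‖) := mul_le_mul_of_nonneg_left hcs (abs_nonneg _)
        _ ≤ |s| * (p.1 * ‖v‖) := by
            refine mul_le_mul_of_nonneg_left ?_ (abs_nonneg _)
            exact mul_le_mul_of_nonneg_right hpc (norm_nonneg _)
        _ = |s| * ‖v‖ * p.1 := by ring
    rw [ht'_def]
    nlinarith [h1, hp.1]

end Summit.CriticalPhenomena.Ising3DConformalLimit.Cruxes.HRP2Rigidity.LaplaceLightconeBootstrap

end
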